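import Literature.IUT.LogThetaLattice.ThetaPilotObjects
import HarnessLib

/-!
# [IUTchIII] Definition 3.8 (ii): NON-VACUITY of the interface `ThetaLinkStrips` — its exact inhabitation
# condition, and the witness carried by every Proposition 3.7 output signature

Mochizuki, *Inter-universal Teichmüller theory III*, kurims manuscript (May 2020), §3, Definition 3.8 (ii),
p. 113 (the `𝓕^{⊩▶×μ}`-prime-strips `†𝔉^{⊩▶×μ}_LGP`, `†𝔉^{⊩▶×μ}_lgp`, `*𝔉^{⊩▶×μ}_△` entering the
Θ^{×μ}_{LGP}- / Θ^{×μ}_{lgp}-links) and Proposition 3.7 (iii), (iv), pp. 110–111 (the strips `†𝔉^⊩_LGP`,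
`†𝔉^⊩_lgp` with `†𝔉^⊩_gau ≅ †𝔉^⊩_LGP ≅ †𝔉^⊩_lgp`) [claim: Mochizuki2012, status: disputed] (D-0012 claim key;
record-only vocabulary; this file takes no side).

abc-iut cell, layer L6, NON-VACUITY CERTIFICATE (L6-lead §F v1.18p «NV-L6 WAVE»; plan/ADJUDICATION-SPEC §4 (iii))
for abc-iut-L6-t4's interface `Literature.IUT.LogThetaLattice.ThetaLinkStrips LogLink Strip`
(`ThetaPilotObjects.lean`): the datum `D : ThetaLinkStrips P.LogLink P.Strip` is a binder of every Team-A census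
theorem of the [IUTchIII] Cor. 3.12 cone (`Cor312Proof.teamA_chain`, `teamA_statement_end_to_end(_of_edge …)`,
`Cor312StepXIabcReal.stepXIa_holds` …), so its inhabitation is part of their non-vacuity.  The interface is a
pure DATA record (three strip-valued assignments, no law), hence the kernel facts are short and exact:

* `ThetaLinkStrips.nonempty_iff` — `ThetaLinkStrips LogLink Strip` is inhabited IFF `Strip` is inhabited as
  soon as the index type `HT` of Hodge theaters is (`Nonempty HT → Nonempty Strip`); with an LGP-Gaussian
  log-theta-lattice present (`HT ∋ ^{0,0}𝓗𝓣`) this is just `Nonempty Strip` (`nonempty_iff_of_lattice`).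
* `ThetaLinkStrips.nonempty_of_signature` — the MODEL-LEVEL witness: every output signature
  `S : GlobalLGPFrobenioidSignature …` of Proposition 3.7 carries the strips `S.FLGP = †𝔉^⊩_LGP`,
  `S.Flgp = †𝔉^⊩_lgp`, `S.Fgau = †𝔉^⊩_gau`, and `(lg ↦ S.FLGP, lg ↦ S.Flgp, ⋆ ↦ S.Fgau)` is a `ThetaLinkStrips`
  datum over the SAME `Strip` type — so at every `Cor312.Setting P` of the tree (whose field `P.sig` is such a
  signature over `P.Strip`) the census binder is inhabited: `⟨fun _ => P.sig.FLGP, fun _ => P.sig.Flgp,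
  fun _ => P.sig.Fgau⟩ : ThetaLinkStrips P.LogLink P.Strip` (recorded Summits-side, together with the census's
  strip-isomorphism slot `hNE`, in `Summits/ABC/IUTFork/Cor312ThetaLinkStripsNonVacuity.lean`).
HONEST LABEL: the frozen `Cor312.Setting` carries ONE signature (not a theater-indexed family), so this witness
is CONSTANT in the log-link / theater argument; it is model-level in its strip values (the genuine
`†𝔉^⊩_LGP`, `†𝔉^⊩_lgp`, `†𝔉^⊩_gau` of the signature), degenerate in its indexing.  The theater-indexed genuine
family needs theater-indexed signatures (abc-iut-L6-t4 / c312-7, TODO-merge).  Already in tree before this file: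
the pointwise facts `ThetaLinkStrips.nonempty_of_strip` / `nonempty_strip` (abc-iut-w5-d114, `InterfaceNonVacuity.lean`,
p418713 — not imported here, olean pending at filing; the two one-liners are inlined) and an ∃-producer with
`Strip := Unit` inside `Cor312Proof.honestCensus_premises_not_imp_gap_contentful` (abc-iut-c312-10,
`Cor312TeamAHonestCensusContentful`, p418534).
Theorems only: no `def`, no `instance`, no `Prop` fact; nothing here bears on [IUTchIII] Cor. 3.12.
-/

namespace Literature.IUT.LogThetaLattice

universe u v w x

namespace ThetaLinkStrips

variable {HT : Type u} {LogLink : HT → HT → Type v} {Strip : Type u}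

/-- Inhabitation from the weakest possible input: a strip for every INHABITED theater type (choice).
[cite: Mochizuki2012, III Def 3.8 (ii) p.113] -/
theorem nonempty_of_imp (h : Nonempty HT → Nonempty Strip) : Nonempty (ThetaLinkStrips LogLink Strip) :=
  ⟨⟨fun {s} {_} _ => Classical.choice (h ⟨s⟩), fun {s} {_} _ => Classical.choice (h ⟨s⟩),
    fun s => Classical.choice (h ⟨s⟩)⟩⟩

/-- **Exact inhabitation condition of the interface**: `ThetaLinkStrips LogLink Strip` is inhabited iff
`Strip` is inhabited whenever the theater type `HT` is. [cite: Mochizuki2012, III Def 3.8 (ii) p.113] -/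
theorem nonempty_iff : Nonempty (ThetaLinkStrips LogLink Strip) ↔ (Nonempty HT → Nonempty Strip) :=
  ⟨fun ⟨D⟩ ⟨s⟩ => ⟨D.stripDelta s⟩, nonempty_of_imp⟩

/-- With an LGP-Gaussian log-theta-lattice present ([IUTchIII] Def. 3.8 (iii), p. 113: the theaters
`^{n,m}𝓗𝓣`, e.g. `^{0,0}𝓗𝓣`, inhabit `HT`), the condition is simply `Nonempty Strip`.
[cite: Mochizuki2012, III Def 3.8 (iii) p.113] -/
theorem nonempty_iff_of_lattice {IsFull : ∀ {s t : HT}, LogLink s t → Prop}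
    (L : LGPGaussianLogThetaLattice LogLink IsFull) :
    Nonempty (ThetaLinkStrips LogLink Strip) ↔ Nonempty Strip :=
  ⟨fun ⟨D⟩ => ⟨D.stripDelta (L.theater 0 0)⟩, fun ⟨F⟩ => ⟨⟨fun _ => F, fun _ => F, fun _ => F⟩⟩⟩

/-- **Model-level witness from a Proposition 3.7 output signature** ([IUTchIII] Prop. 3.7 (iii)/(iv),
pp. 110–111; Def. 3.8 (ii), p. 113): the signature's own strips `†𝔉^⊩_LGP`, `†𝔉^⊩_lgp`, `†𝔉^⊩_gau` give the
datum `(lg ↦ S.FLGP, lg ↦ S.Flgp, ⋆ ↦ S.Fgau)` — constant in the log-link because ONE signature is given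
(honest label in the module docstring). [cite: Mochizuki2012, III Prop 3.7 (iii) p.110] -/
theorem nonempty_of_signature {lstar : ℕ} {V : Type x} {isBad : V → Prop} {Frd : Type u}
    {IsoF : Frd → Frd → Type w} {Ob : Frd → Type w} {realify : Frd → Frd} {IsoS : Strip → Strip → Type w}
    {M : ∀ y : V, isBad y → Type w}
    (S : GlobalLGPFrobenioidSignature lstar V isBad Frd IsoF Ob realify Strip IsoS M) :
    Nonempty (ThetaLinkStrips LogLink Strip) :=
  ⟨⟨fun _ => S.FLGP, fun _ => S.Flgp, fun _ => S.Fgau⟩⟩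

/-- The three components of the signature witness, read back (bookkeeping for consumers that
destructure the datum). [cite: Mochizuki2012, III Def 3.8 (ii) p.113] -/
theorem exists_eq_signature {lstar : ℕ} {V : Type x} {isBad : V → Prop} {Frd : Type u}
    {IsoF : Frd → Frd → Type w} {Ob : Frd → Type w} {realify : Frd → Frd} {IsoS : Strip → Strip → Type w}
    {M : ∀ y : V, isBad y → Type w}
    (S : GlobalLGPFrobenioidSignature lstar V isBad Frd IsoF Ob realify Strip IsoS M) :
    ∃ D : ThetaLinkStrips LogLink Strip,
      (∀ {s t : HT} (lg : LogLink s t), D.stripLGP lg = S.FLGP ∧ D.stripLgp lg = S.Flgp) ∧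
        ∀ s : HT, D.stripDelta s = S.Fgau :=
  ⟨⟨fun _ => S.FLGP, fun _ => S.Flgp, fun _ => S.Fgau⟩, fun _ => ⟨rfl, rfl⟩, fun _ => rfl⟩

end ThetaLinkStrips

end Literature.IUT.LogThetaLattice
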